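import Mathlib.RingTheory.Valuation.Basic
import Mathlib.Algebra.Order.GroupWithZero.Basic
import Mathlib.Tactic
import HarnessLib

set_option linter.dupNamespace false -- `Summit.BirchSwinnertonDyer.BirchSwinnertonDyer.Theorems.…` (summit = sub, D-0017)
set_option autoImplicit false

/-!
# Crux `ManinDatumSupercuspidalCMInert` (stmt-BirchSwinnertonDyer-20111, BED r605), CM side of H₇ — step (d) of memo PLAIN-ODD-57,
# first brick: the chord law is ADDITIVE TO FIRST ORDER in the parameter `z = x/y` at points of the formal group

Route `BiquadraticEisensteinDescent` (cell `pub/bsd-wall`, width seat `bsd-wall-cm-bed-w4` g11, RESOLVENT LANE; `--supports`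
stmt-BirchSwinnertonDyer-20111, helper). THEOREMS ONLY (no definition, no named fact, no `sorry`); nothing is closed by this file and BSD is
not proved by any of it.

The Galois input (d) of `…TameResolvent.resolvent_valuation_le` (design note `Cruxes/ManinDatumSupercuspidalCMInert/MODEL-ASSEMBLY-LANES-w2g10.md`,
X-FORMAL route) needs the TAME CHARACTER of `ℚ(i)(E₀[7])/ℚ(i)` pinned: `θ(σ_u) = t(uQ)/t(Q) ≡ u (mod 𝔪)` for `t = x/y`, i.e. that `Q ↦ t(Q)` is
`ℤ[i]`-linear to first order on the `7`-division points of `y² = x³ − x`. `[i]` acts exactly (`t(iQ) = i·t(Q)`); this file proves the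
additive half by FINITE ALGEBRA in an arbitrary valued field — no formal groups, no power series, no completions:

* `cubic_vieta_of_three_roots` — if a cubic `aζ³ + bζ² + cζ + d` vanishes at three pairwise distinct `ζ₁, ζ₂, ζ₃` then
  `a(ζ₁ + ζ₂ + ζ₃) + b = 0` (two divided differences; no splitting, no multiplicities);
* `zw_curve` — in the chart `z = x/y`, `w = 1/y` the curve `y² = x³ − x` reads `w = z³ − z·w²`;
* `zw_slope_mul` — the chord through two points of that cubic has slope `λ′ = (z₁² + z₁z₂ + z₂² − w₂²)/(1 + z₁(w₁ + w₂))` (a polynomial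
  identity modulo the two curve relations: the denominator is a UNIT at formal points, so no lower bound on `x₁ − x₂` is ever needed);
* ★ `val_formalParameter_add_le` — **first-order additivity**: for three points `P₁, P₂, P₃ = P₁ + P₂` of `y² = x³ − x` (collinearity of
  `P₁, P₂, −P₃` on a line `y = Lx + M`) with `z₁, z₂, −z₃` pairwise distinct and `v(zᵢ) ≤ ρ`, `v(1/yᵢ) ≤ ρ³` (`i = 1,2`, `ρ < 1`):
  `v(z₃ − z₁ − z₂) ≤ ρ⁵` — the chord in the `(z,w)`-chart is `w = λ′z + ν′` with `v λ′ ≤ ρ²`, `v ν′ ≤ ρ³`, and Vieta on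
  `(1 − λ′²)ζ³ − 2λ′ν′ζ² − (ν′² + λ′)ζ − ν′` gives `z₁ + z₂ − z₃ = 2λ′ν′/(1 − λ′²)`. (Silverman's `z₃ = z₁ + z₂ + (deg ≥ 2)` read
  valuation-theoretically; with `ρ = v(7)^{1/48}` this is `t(P₁ + P₂) ≡ t(P₁) + t(P₂) (mod 𝔪·t)` on `E₀[7]`.)

References: [SilvermanAEC2009] IV.1 (the expansion around `O`: `z = −x/y`, `w = −1/y`, `w = z³ + a₄zw² + …`, and the group law
`F(z₁,z₂) = z₁ + z₂ + …`, Prop. IV.1.2 / eq. before IV.2), III.2.3 (chord law).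
-/

noncomputable section

namespace Summit.BirchSwinnertonDyer.BirchSwinnertonDyer.Theorems.BiquadraticEisensteinDescentManinDatumSupercuspidalCMInertFormalParameterAddition

section Vieta

variable {F : Type*} [Field F]

/-- **Vieta for three distinct roots of a cubic, by divided differences.** If `aζ³ + bζ² + cζ + d = 0` for pairwise distinct
`ζ₁, ζ₂, ζ₃`, then `a(ζ₁ + ζ₂ + ζ₃) + b = 0`. [folklore] -/
theorem cubic_vieta_of_three_roots {a b c d ζ₁ ζ₂ ζ₃ : F}
    (h₁ : a * ζ₁ ^ 3 + b * ζ₁ ^ 2 + c * ζ₁ + d = 0) (h₂ : a * ζ₂ ^ 3 + b * ζ₂ ^ 2 + c * ζ₂ + d = 0)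
    (h₃ : a * ζ₃ ^ 3 + b * ζ₃ ^ 2 + c * ζ₃ + d = 0) (h12 : ζ₁ ≠ ζ₂) (h13 : ζ₁ ≠ ζ₃) (h23 : ζ₂ ≠ ζ₃) :
    a * (ζ₁ + ζ₂ + ζ₃) + b = 0 := by
  have e12 : a * (ζ₁ ^ 2 + ζ₁ * ζ₂ + ζ₂ ^ 2) + b * (ζ₁ + ζ₂) + c = 0 := by
    have h : (ζ₁ - ζ₂) * (a * (ζ₁ ^ 2 + ζ₁ * ζ₂ + ζ₂ ^ 2) + b * (ζ₁ + ζ₂) + c) = 0 := by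
      linear_combination h₁ - h₂
    exact (mul_eq_zero.mp h).resolve_left (sub_ne_zero.mpr h12)
  have e13 : a * (ζ₁ ^ 2 + ζ₁ * ζ₃ + ζ₃ ^ 2) + b * (ζ₁ + ζ₃) + c = 0 := by
    have h : (ζ₁ - ζ₃) * (a * (ζ₁ ^ 2 + ζ₁ * ζ₃ + ζ₃ ^ 2) + b * (ζ₁ + ζ₃) + c) = 0 := by
      linear_combination h₁ - h₃
    exact (mul_eq_zero.mp h).resolve_left (sub_ne_zero.mpr h13)
  have h : (ζ₂ - ζ₃) * (a * (ζ₁ + ζ₂ + ζ₃) + b) = 0 := by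
    linear_combination e12 - e13
  exact (mul_eq_zero.mp h).resolve_left (sub_ne_zero.mpr h23)

/-- **The curve `y² = x³ − x` in the chart `z = x/y`, `w = 1/y`**: `w = z³ − z w²` (divide by `y³`). [cite: SilvermanAEC2009, IV.1] -/
theorem zw_curve {X Y : F} (h : Y ^ 2 = X ^ 3 - X) (hY : Y ≠ 0) :
    Y⁻¹ = (X / Y) ^ 3 - (X / Y) * Y⁻¹ ^ 2 := by
  field_simp
  linear_combination h

/-- The same chart for the NEGATIVE of a point: `(−z, −w)` satisfies the same (odd) relation. [cite: SilvermanAEC2009, IV.1] -/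
theorem zw_curve_neg {X Y : F} (h : Y ^ 2 = X ^ 3 - X) (hY : Y ≠ 0) :
    -Y⁻¹ = (-(X / Y)) ^ 3 - (-(X / Y)) * (-Y⁻¹) ^ 2 := by
  have := zw_curve h hY
  linear_combination (-1 : F) * this

/-- **Slope of the chord in the `(z,w)`-chart.** If `wᵢ = zᵢ³ − zᵢwᵢ²` (`i = 1, 2`) then
`(w₂ − w₁)(1 + z₁(w₁ + w₂)) = (z₂ − z₁)(z₁² + z₁z₂ + z₂² − w₂²)`. [cite: SilvermanAEC2009, IV.1 (λ ∈ ℤ[a₁,…,a₆]⟦z₁,z₂⟧)] -/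
theorem zw_slope_mul {z₁ w₁ z₂ w₂ : F} (h₁ : w₁ = z₁ ^ 3 - z₁ * w₁ ^ 2) (h₂ : w₂ = z₂ ^ 3 - z₂ * w₂ ^ 2) :
    (w₂ - w₁) * (1 + z₁ * (w₁ + w₂)) = (z₂ - z₁) * (z₁ ^ 2 + z₁ * z₂ + z₂ ^ 2 - w₂ ^ 2) := by
  linear_combination h₂ - h₁

/-- A point `(ζ, ω)` of `w = z³ − zw²` on the line `ω = λ′ζ + ν′` is a root of the cubic
`(1 − λ′²)ζ³ − 2λ′ν′ζ² − (ν′² + λ′)ζ − ν′`. [cite: SilvermanAEC2009, IV.1] -/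
theorem zw_cubic_of_line {ζ ω l n : F} (hc : ω = ζ ^ 3 - ζ * ω ^ 2) (hl : ω = l * ζ + n) :
    (1 - l ^ 2) * ζ ^ 3 + (-(2 * l * n)) * ζ ^ 2 + (-(n ^ 2 + l)) * ζ + (-n) = 0 := by
  rw [hl] at hc
  linear_combination (-1 : F) * hc

end Vieta

section Valued

variable {F Γ₀ : Type*} [Field F] [LinearOrderedCommGroupWithZero Γ₀] (v : Valuation F Γ₀)

/-- `v 2 ≤ 1`. [folklore] -/
theorem val_two_le_one : v (2 : F) ≤ 1 := by
  have := Valuation.map_add_le v (x := (1 : F)) (y := 1) (le_of_eq (Valuation.map_one v)) (le_of_eq (Valuation.map_one v))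
  norm_num at this
  exact this

/-- ★ **The chord law is additive to first order in `z = x/y` at formal points.** Let `Pᵢ = (Xᵢ, Yᵢ)` (`i = 1,2,3`) be points of
`y² = x³ − x` in a valued field with `Yᵢ ≠ 0`, such that `P₁`, `P₂` and `−P₃ = (X₃, −Y₃)` lie on one line `y = Lx + M` (so
`P₃ = P₁ + P₂` by the chord law) and the parameters `z₁ = X₁/Y₁`, `z₂ = X₂/Y₂`, `−z₃ = −X₃/Y₃` are pairwise distinct. If
`v(z₁), v(z₂) ≤ ρ` and `v(1/Y₁), v(1/Y₂) ≤ ρ³` for some `ρ < 1`, then `v(z₃ − z₁ − z₂) ≤ ρ⁵`.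
(In the `(z,w)`-chart the chord is `w = λ′z + ν′` with `v λ′ ≤ ρ²`, `v ν′ ≤ ρ³`; Vieta for the three distinct roots `z₁, z₂, −z₃` of
`(1 − λ′²)ζ³ − 2λ′ν′ζ² − (ν′² + λ′)ζ − ν′` gives `z₁ + z₂ − z₃ = 2λ′ν′/(1 − λ′²)`.) [cite: SilvermanAEC2009, IV.1 and III.2.3] -/
theorem val_formalParameter_add_le {X₁ Y₁ X₂ Y₂ X₃ Y₃ L M : F}
    (h₁ : Y₁ ^ 2 = X₁ ^ 3 - X₁) (h₂ : Y₂ ^ 2 = X₂ ^ 3 - X₂) (h₃ : Y₃ ^ 2 = X₃ ^ 3 - X₃)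
    (hY₁ : Y₁ ≠ 0) (hY₂ : Y₂ ≠ 0) (hY₃ : Y₃ ≠ 0)
    (hl₁ : Y₁ = L * X₁ + M) (hl₂ : Y₂ = L * X₂ + M) (hl₃ : -Y₃ = L * X₃ + M)
    (h12 : X₁ / Y₁ ≠ X₂ / Y₂) (h13 : X₁ / Y₁ ≠ -(X₃ / Y₃)) (h23 : X₂ / Y₂ ≠ -(X₃ / Y₃))
    {ρ : Γ₀} (hρ : ρ < 1) (hz₁ : v (X₁ / Y₁) ≤ ρ) (hz₂ : v (X₂ / Y₂) ≤ ρ)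
    (hw₁ : v Y₁⁻¹ ≤ ρ ^ 3) (hw₂ : v Y₂⁻¹ ≤ ρ ^ 3) :
    v (X₃ / Y₃ - X₁ / Y₁ - X₂ / Y₂) ≤ ρ ^ 5 := by
  -- the `(z, w)`-chart
  set z₁ : F := X₁ / Y₁ with hz₁def
  set z₂ : F := X₂ / Y₂ with hz₂def
  set z₃ : F := X₃ / Y₃ with hz₃def
  set w₁ : F := Y₁⁻¹ with hw₁def
  set w₂ : F := Y₂⁻¹ with hw₂def
  set w₃ : F := Y₃⁻¹ with hw₃def
  have hc₁ : w₁ = z₁ ^ 3 - z₁ * w₁ ^ 2 := zw_curve h₁ hY₁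
  have hc₂ : w₂ = z₂ ^ 3 - z₂ * w₂ ^ 2 := zw_curve h₂ hY₂
  have hc₃ : -w₃ = (-z₃) ^ 3 - (-z₃) * (-w₃) ^ 2 := zw_curve_neg h₃ hY₃
  -- the line in the `(z, w)`-chart: `L ζ + M ω = 1` at the three points `(z₁,w₁)`, `(z₂,w₂)`, `(−z₃,−w₃)`
  have hL₁ : L * z₁ + M * w₁ = 1 := by
    rw [hz₁def, hw₁def]; field_simp; linear_combination (-1 : F) * hl₁
  have hL₂ : L * z₂ + M * w₂ = 1 := by
    rw [hz₂def, hw₂def]; field_simp; linear_combination (-1 : F) * hl₂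
  have hL₃ : L * (-z₃) + M * (-w₃) = 1 := by
    rw [hz₃def, hw₃def]; field_simp; linear_combination hl₃
  -- `ρ > 0` unless degenerate; basic valuation facts
  have hz12 : z₂ - z₁ ≠ 0 := sub_ne_zero.mpr (Ne.symm h12)
  -- the slope `λ′` and intercept `ν′`
  set l : F := (w₂ - w₁) / (z₂ - z₁) with hldef
  set n : F := w₁ - l * z₁ with hndef
  have hline₁ : w₁ = l * z₁ + n := by rw [hndef]; ring
  have hline₂ : w₂ = l * z₂ + n := by
    rw [hndef, hldef]; field_simp; ring
  -- `M ≠ 0` (else `L z₁ = 1 = L z₂` forces `z₁ = z₂`)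
  have hM : M ≠ 0 := by
    intro hM0
    rw [hM0, zero_mul, add_zero] at hL₁ hL₂
    apply h12
    have hL0 : L ≠ 0 := by rintro rfl; simp at hL₁
    calc z₁ = L⁻¹ := by rw [eq_inv_of_mul_eq_one_right hL₁]
      _ = z₂ := by rw [eq_inv_of_mul_eq_one_right hL₂]
  -- the third point is on the same `(z,w)`-line
  have hlM : l = -L / M := by
    have e : M * (w₂ - w₁) = -L * (z₂ - z₁) := by linear_combination hL₂ - hL₁
    rw [hldef, eq_div_iff hM]
    field_simp
    linear_combination e
  have hline₃ : -w₃ = l * (-z₃) + n := by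
    have e : M * (-w₃ - w₁) = -L * (-z₃ - z₁) := by linear_combination hL₃ - hL₁
    have e' : -w₃ - w₁ = l * (-z₃ - z₁) := by
      rw [hlM]
      field_simp
      linear_combination e
    rw [hndef]
    linear_combination e'
  -- `λ′ = N / D` with `D` a unit and `v N ≤ ρ²`
  have hslope : (w₂ - w₁) * (1 + z₁ * (w₁ + w₂)) = (z₂ - z₁) * (z₁ ^ 2 + z₁ * z₂ + z₂ ^ 2 - w₂ ^ 2) :=
    zw_slope_mul hc₁ hc₂
  have hρ3 : ρ ^ 3 ≤ ρ := by
    rcases eq_or_ne ρ 0 with h0 | h0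
    · rw [h0, zero_pow three_ne_zero]
    · exact pow_le_of_le_one (zero_le) hρ.le (by norm_num)
  have hvw₁ : v w₁ ≤ ρ ^ 3 := hw₁
  have hvw₂ : v w₂ ≤ ρ ^ 3 := hw₂
  have hD : v (1 + z₁ * (w₁ + w₂)) = 1 := by
    refine Valuation.map_one_add_of_lt v ?_
    rw [Valuation.map_mul]
    calc v z₁ * v (w₁ + w₂) ≤ ρ * ρ ^ 3 := by
          refine mul_le_mul' hz₁ (Valuation.map_add_le v hvw₁ hvw₂)
      _ = ρ ^ 4 := (pow_succ' ρ 3).symm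
      _ < 1 := pow_lt_one₀ zero_le hρ (by norm_num)
  have hD0 : 1 + z₁ * (w₁ + w₂) ≠ 0 := by
    intro h; rw [h, Valuation.map_zero] at hD; exact zero_ne_one hD
  have hN : v (z₁ ^ 2 + z₁ * z₂ + z₂ ^ 2 - w₂ ^ 2) ≤ ρ ^ 2 := by
    have hρ6 : ρ ^ 6 ≤ ρ ^ 2 := by
      rw [show (6 : ℕ) = 3 * 2 from rfl, pow_mul]
      exact pow_le_pow_left₀ zero_le hρ3 2
    refine Valuation.map_sub_le v (Valuation.map_add_le v (Valuation.map_add_le v ?_ ?_) ?_) ?_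
    · rw [Valuation.map_pow]; exact pow_le_pow_left₀ zero_le hz₁ 2
    · rw [Valuation.map_mul, pow_two]; exact mul_le_mul' hz₁ hz₂
    · rw [Valuation.map_pow]; exact pow_le_pow_left₀ zero_le hz₂ 2
    · rw [Valuation.map_pow]
      exact (pow_le_pow_left₀ zero_le hvw₂ 2).trans (by rw [← pow_mul]; exact hρ6)
  have hl_eq : l = (z₁ ^ 2 + z₁ * z₂ + z₂ ^ 2 - w₂ ^ 2) / (1 + z₁ * (w₁ + w₂)) := by
    rw [hldef, div_eq_div_iff hz12 hD0, hslope]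
    ring
  have hvl : v l ≤ ρ ^ 2 := by
    rw [hl_eq, map_div₀, hD, div_one]; exact hN
  have hvn : v n ≤ ρ ^ 3 := by
    rw [hndef]
    refine Valuation.map_sub_le v hvw₁ ?_
    rw [Valuation.map_mul]
    calc v l * v z₁ ≤ ρ ^ 2 * ρ := mul_le_mul' hvl hz₁
      _ = ρ ^ 3 := (pow_succ ρ 2).symm
  -- the cubic and Vieta
  have hr₁ := zw_cubic_of_line hc₁ hline₁
  have hr₂ := zw_cubic_of_line hc₂ hline₂
  have hr₃ := zw_cubic_of_line hc₃ hline₃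
  have h13' : z₁ ≠ -z₃ := h13
  have h23' : z₂ ≠ -z₃ := h23
  have hvieta := cubic_vieta_of_three_roots hr₁ hr₂ hr₃ h12 h13' h23'
  -- `1 − λ′²` is a unit
  have hunit : v (1 - l ^ 2) = 1 := by
    rw [sub_eq_add_neg]
    refine Valuation.map_one_add_of_lt v ?_
    rw [Valuation.map_neg, Valuation.map_pow]
    calc v l ^ 2 ≤ (ρ ^ 2) ^ 2 := pow_le_pow_left₀ zero_le hvl 2
      _ = ρ ^ 4 := (pow_mul ρ 2 2).symm
      _ < 1 := pow_lt_one₀ zero_le hρ (by norm_num)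
  have hunit0 : 1 - l ^ 2 ≠ 0 := by
    intro h; rw [h, Valuation.map_zero] at hunit; exact zero_ne_one hunit
  have hkey : z₃ - z₁ - z₂ = -(2 * l * n) / (1 - l ^ 2) := by
    rw [eq_div_iff hunit0]
    linear_combination (-1 : F) * hvieta
  rw [hkey, map_div₀, hunit, div_one, Valuation.map_neg, Valuation.map_mul, Valuation.map_mul]
  calc v 2 * v l * v n ≤ 1 * ρ ^ 2 * ρ ^ 3 := by
        refine mul_le_mul' (mul_le_mul' (val_two_le_one v) hvl) hvn
    _ = ρ ^ 5 := by rw [one_mul, ← pow_add]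

end Valued

end Summit.BirchSwinnertonDyer.BirchSwinnertonDyer.Theorems.BiquadraticEisensteinDescentManinDatumSupercuspidalCMInertFormalParameterAddition

end
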